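import Summits.BirchSwinnertonDyer.BirchSwinnertonDyer.Theorems.PrintCFramBottomClassIndexLawFiveLeBernoulliUnitsFourLifts
import HarnessLib

/-!
# Crux `PrintCFram.BottomClassIndexLawFiveLe` (stmt-BirchSwinnertonDyer-20372), line `eisenstein-resource-bdp-line` (registry v11 → v12, ROAD C):
# THE BERNOULLI UNITS OF THE KRIZ–LI DATUM, part R — MAZUR–WILES-READY avatars for stubs O and E of ROAD C:
# an ODD lift `λ` (stub O's `r₁`) and `ω·λ⁻¹` for an EVEN lift `λ` (stub E's reflection character `ω r₂⁻¹`) are delivered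
# as PRIMITIVE, ODD, `≠ ω`, with `‖B_{1,χ̃⁻¹}‖_p = 1` — from Stub H's binders alone
# (cell `bsd-print-cfram`, width seat `bsd-line-cfram-p1-w3` g4; THEOREMS ONLY, `--supports` 20372; BSD is not proved by any of this)

HONEST FRAMING. Nothing here is a statement about BSD; no stub of the skeleton is closed. LEAD g9's ROAD C (STATUS 17:46Z / 18:01Z):
stub O = «Mazur–Wiles ⟹ ODD(r₁, N)» consumes w6's `HerbrandOddClassGroup.absGaloisHom_eq_one_final` whose Dirichlet hypotheses are
`χ.IsPrimitive`, `χ.Odd`, `¬ ∀ a ⊥ p, ‖χ a − a‖ < 1`, `‖bernoulliOnePrim χ⁻¹‖ = 1` for the avatar `χ` of the odd lift `r₁`; stub E =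
«Mazur–Wiles ⟹ EVEN(r₂, N′)» consumes w8's Kummer reflection whose Mazur–Wiles input is the ODD character `ω r₂⁻¹`. With `λ` the
Dirichlet avatar of the lift in question (`λ↑ ∈ {ψ₁↑, ψ₁↑ε_K↑, ψ₁⁻¹↑ω↑, ψ₁⁻¹↑ω↑ε_K↑}`, part III), this file delivers BOTH four-tuples:

* **`mazurWilesReady_of_odd_lift`**: `λ` odd ⟹ for `χ := λ.primitiveCharacter`: primitive ∧ odd ∧ «≠ ω» ∧ `‖bernoulliOnePrim χ⁻¹‖ = 1`;
* `omega_mul_inv_odd`, `inv_omega_mul_inv_eq`, **`mazurWilesReady_of_even_lift`**: `λ` even ⟹ the same four-tuple for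
  `χ := (ω↑·λ↑⁻¹).primitiveCharacter` (level `n·p`).

beyond-print theorem: NO. References: [KrizLi2019] Thm. 1.20, §7.1; [MazurWiles1984] Thm. 2; [Washington1997] Thm. 10.9; LEAD g9 ROAD C plan.
-/

set_option autoImplicit false
set_option linter.dupNamespace false

noncomputable section

open scoped Classical
open DirichletCharacter Literature.NumberTheory.LFunctions Literature.NumberTheory.EllipticCurves.KrizLi2019
  Literature.NumberTheory.EllipticCurves Literature.NumberTheory.EllipticCurves.Rank1Residual

namespace Summit.BirchSwinnertonDyer.BirchSwinnertonDyer.Theorems.PrintCFram.BernoulliUnits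

open Summit.BirchSwinnertonDyer.BirchSwinnertonDyer.Theorems.PrintCFram

variable {p : ℕ} [hp : Fact p.Prime]

section Generic

variable {n : ℕ} [NeZero n]

/-- For an even `λ` and an odd `ω`, the character `ω↑·λ↑⁻¹` (level `n·p`) is ODD. [cite: KrizLi2019, §1.5 (p. 7)] -/
theorem omega_mul_inv_odd (lam : DirichletCharacter ℚ_[p] n) {ω : DirichletCharacter ℚ_[p] p} (hω : ω.Odd) (heven : lam.Even) :
    (changeLevel (dvd_mul_left p n) ω * (changeLevel (dvd_mul_right n p) lam)⁻¹).Odd := by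
  haveI : NeZero (n * p) := ⟨Nat.mul_ne_zero (NeZero.ne n) hp.out.ne_zero⟩
  unfold DirichletCharacter.Odd
  rw [MulChar.mul_apply, MulChar.inv_apply_eq_inv', EisensteinPair.changeLevel_apply_neg_one,
    EisensteinPair.changeLevel_apply_neg_one, hω, heven, inv_one, mul_one]

omit [NeZero n] in
/-- `(ω↑·λ↑⁻¹)⁻¹ = λ↑·ω⁻¹↑` — the character of part III's even-lift statement. [folklore] -/
theorem inv_omega_mul_inv_eq (lam : DirichletCharacter ℚ_[p] n) (ω : DirichletCharacter ℚ_[p] p) :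
    (changeLevel (dvd_mul_left p n) ω * (changeLevel (dvd_mul_right n p) lam)⁻¹)⁻¹ =
      changeLevel (dvd_mul_right n p) lam * changeLevel (dvd_mul_left p n) ω⁻¹ := by
  simp only [mul_inv, inv_inv, map_inv, mul_comm]

end Generic

section RoadC

variable (W : WeierstrassCurve ℚ) [W.IsElliptic] [W.IsGloballyMinimal]

/-- **STUB O's MAZUR–WILES INPUT (Dirichlet side), from Stub H's binders.** Setting of part III's `fourLifts_of_heegner`; if the lift
`λ` is ODD (the avatar of ROAD C's `r₁`), then `χ := λ.primitiveCharacter` is PRIMITIVE, ODD, satisfies «`χ ≠ ω`»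
(`¬ ∀ a ⊥ p, ‖χ a − a‖ < 1`) and `‖bernoulliOnePrim χ⁻¹‖_p = 1` — the four Dirichlet hypotheses of w6's
`HerbrandOddClassGroup.absGaloisHom_eq_one_final`. [cite: MazurWiles1984, Thm. 2 (p. 216)] [cite: KrizLi2019, Thm. 1.20 (pp. 7–8), §7.1] -/
theorem mazurWilesReady_of_odd_lift (hCM : W.HasCM) (hram : CMRamified W p) (h5 : 5 ≤ p)
    (N : ℕ) (K : Type) [Field K] [NumberField K]
    {f : ℕ} [NeZero f] (ψ : DirichletCharacter ℚ_[p] f) (ω : DirichletCharacter ℚ_[p] p)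
    (εK : DirichletCharacter ℚ_[p] (NumberField.discr K).natAbs)
    (hN : W.conductorNorm ℤ = N) (hK : IsImaginaryQuadratic K) (hH : SatisfiesHeegnerHypothesis N K)
    (hω : IsTeichmullerCharacter ω)
    (hss : ∀ ℓ : ℕ, ℓ.Prime → ¬ (ℓ ∣ p * W.conductorNorm ℤ) →
      ‖((W.LFunction ℓ : ℤ) : ℚ_[p]) - (ψ (ℓ : ZMod f) + ψ⁻¹ (ℓ : ZMod f) * ω (ℓ : ZMod p))‖ < 1)
    (hεK : IsKroneckerCharacterOf K εK)
    (h4 : ¬ ‖bernoulliOnePrim (bernoulliCharOne ψ εK) * bernoulliOnePrim (bernoulliCharTwo ψ εK ω)‖ ≤ (p : ℝ)⁻¹)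
    {m : ℕ} [NeZero m] (ψ₁ : DirichletCharacter ℚ_[p] m) {M : ℕ} [NeZero M] (hf : f ∣ M) (hm : m ∣ M) (hpM : p ∣ M)
    (e : changeLevel hf ψ = changeLevel hm ψ₁ ∨ changeLevel hf ψ = changeLevel hm ψ₁⁻¹ * changeLevel hpM ω)
    {n : ℕ} [NeZero n] (lam : DirichletCharacter ℚ_[p] n) {M' : ℕ} [NeZero M'] (hn : n ∣ M') (hm' : m ∣ M')
    (hd : (NumberField.discr K).natAbs ∣ M') (hpM' : p ∣ M') (hmd : m * (NumberField.discr K).natAbs ∣ M')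
    (hmdp : m * (NumberField.discr K).natAbs * p ∣ M')
    (el : changeLevel hn lam = changeLevel hm' ψ₁ ∨ changeLevel hn lam = changeLevel hm' ψ₁ * changeLevel hd εK ∨
      changeLevel hn lam = changeLevel hm' ψ₁⁻¹ * changeLevel hpM' ω ∨
      changeLevel hn lam = changeLevel hm' ψ₁⁻¹ * changeLevel hpM' ω * changeLevel hd εK)
    (hodd : lam.Odd) :
    lam.primitiveCharacter.IsPrimitive ∧ lam.primitiveCharacter.Odd ∧
      (¬ ∀ a : ℤ, ¬ ((p : ℤ) ∣ a) → ‖lam.primitiveCharacter (a : ZMod lam.conductor) - (a : ℚ_[p])‖ < 1) ∧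
      (haveI : NeZero lam.conductor := ⟨lam.conductor_ne_zero⟩; ‖bernoulliOnePrim lam.primitiveCharacter⁻¹‖ = 1) := by
  have hp2 : p ≠ 2 := by have := hp.out.two_le; omega
  have hB := (fourLifts_of_heegner W hCM hram h5 N K ψ ω εK hN hK hH hω hss hεK h4 ψ₁ hf hm hpM e lam hn hm' hd hpM' hmd
    hmdp el).1 hodd
  exact mazurWiles_dirichletHypotheses'_of_odd_of_norm_eq_one hp2 lam hodd hB

/-- **STUB E's MAZUR–WILES INPUT (Dirichlet side), from Stub H's binders.** Same setting; if the lift `λ` is EVEN (the avatar of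
ROAD C's `r₂`), then for the reflection character `X := ω↑·λ↑⁻¹` (level `n·p`, the avatar of `ω r₂⁻¹`): `χ := X.primitiveCharacter` is
PRIMITIVE, ODD, «`≠ ω`», and `‖bernoulliOnePrim χ⁻¹‖_p = 1` — the Mazur–Wiles input of w8's Kummer reflection.
[cite: MazurWiles1984, Thm. 2 (p. 216)] [cite: Washington1997, Thm. 10.9 (reflection)] [cite: KrizLi2019, Thm. 1.20, §7.1] -/
theorem mazurWilesReady_of_even_lift (hCM : W.HasCM) (hram : CMRamified W p) (h5 : 5 ≤ p)
    (N : ℕ) (K : Type) [Field K] [NumberField K]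
    {f : ℕ} [NeZero f] (ψ : DirichletCharacter ℚ_[p] f) (ω : DirichletCharacter ℚ_[p] p)
    (εK : DirichletCharacter ℚ_[p] (NumberField.discr K).natAbs)
    (hN : W.conductorNorm ℤ = N) (hK : IsImaginaryQuadratic K) (hH : SatisfiesHeegnerHypothesis N K)
    (hω : IsTeichmullerCharacter ω)
    (hss : ∀ ℓ : ℕ, ℓ.Prime → ¬ (ℓ ∣ p * W.conductorNorm ℤ) →
      ‖((W.LFunction ℓ : ℤ) : ℚ_[p]) - (ψ (ℓ : ZMod f) + ψ⁻¹ (ℓ : ZMod f) * ω (ℓ : ZMod p))‖ < 1)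
    (hεK : IsKroneckerCharacterOf K εK)
    (h4 : ¬ ‖bernoulliOnePrim (bernoulliCharOne ψ εK) * bernoulliOnePrim (bernoulliCharTwo ψ εK ω)‖ ≤ (p : ℝ)⁻¹)
    {m : ℕ} [NeZero m] (ψ₁ : DirichletCharacter ℚ_[p] m) {M : ℕ} [NeZero M] (hf : f ∣ M) (hm : m ∣ M) (hpM : p ∣ M)
    (e : changeLevel hf ψ = changeLevel hm ψ₁ ∨ changeLevel hf ψ = changeLevel hm ψ₁⁻¹ * changeLevel hpM ω)
    {n : ℕ} [NeZero n] (lam : DirichletCharacter ℚ_[p] n) {M' : ℕ} [NeZero M'] (hn : n ∣ M') (hm' : m ∣ M')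
    (hd : (NumberField.discr K).natAbs ∣ M') (hpM' : p ∣ M') (hmd : m * (NumberField.discr K).natAbs ∣ M')
    (hmdp : m * (NumberField.discr K).natAbs * p ∣ M')
    (el : changeLevel hn lam = changeLevel hm' ψ₁ ∨ changeLevel hn lam = changeLevel hm' ψ₁ * changeLevel hd εK ∨
      changeLevel hn lam = changeLevel hm' ψ₁⁻¹ * changeLevel hpM' ω ∨
      changeLevel hn lam = changeLevel hm' ψ₁⁻¹ * changeLevel hpM' ω * changeLevel hd εK)
    (heven : lam.Even) :
    (haveI : NeZero (n * p) := ⟨Nat.mul_ne_zero (NeZero.ne n) hp.out.ne_zero⟩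
    let X : DirichletCharacter ℚ_[p] (n * p) := changeLevel (dvd_mul_left p n) ω * (changeLevel (dvd_mul_right n p) lam)⁻¹
    haveI : NeZero X.conductor := ⟨X.conductor_ne_zero⟩
    X.primitiveCharacter.IsPrimitive ∧ X.primitiveCharacter.Odd ∧
      (¬ ∀ a : ℤ, ¬ ((p : ℤ) ∣ a) → ‖X.primitiveCharacter (a : ZMod X.conductor) - (a : ℚ_[p])‖ < 1) ∧
      ‖bernoulliOnePrim X.primitiveCharacter⁻¹‖ = 1) := by
  haveI : NeZero (n * p) := ⟨Nat.mul_ne_zero (NeZero.ne n) hp.out.ne_zero⟩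
  have hp2 : p ≠ 2 := by have := hp.out.two_le; omega
  have hωodd : ω.Odd := KrizLiBinders.teichmuller_apply_neg_one hp2 hω
  have hB := (fourLifts_of_heegner W hCM hram h5 N K ψ ω εK hN hK hH hω hss hεK h4 ψ₁ hf hm hpM e lam hn hm' hd hpM' hmd
    hmdp el).2 heven
  refine mazurWiles_dirichletHypotheses'_of_odd_of_norm_eq_one hp2 _ (omega_mul_inv_odd lam hωodd heven) ?_
  rw [inv_omega_mul_inv_eq]; exact hB

end RoadC

end Summit.BirchSwinnertonDyer.BirchSwinnertonDyer.Theorems.PrintCFram.BernoulliUnits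

end
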